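import Mathlib
import Summits.Ventures.PercRepro2.CaseOneTwoMarkBern
import Summits.Ventures.PercRepro2.HalfLTwoMarkBlocks
import Summits.Ventures.PercRepro2.HalfLA2BBlocks
import Summits.Ventures.PercRepro2.HalfLA1BMassesB
import Summits.Ventures.PercRepro2.HalfLA1BNonneg

/-!
# The five blocks of `HalfLA1BPoly` are nonnegative on the ten cells of a probability vector
(blind cell PercRepro2, night-1 g37)

As `HalfLA2BBlocks`, on the cells `cellsA1B`: `blkHH` (BHK06 1.3 in `C(a₂)`, `CaseOne.tm_bhk_same_a2`),
`blkLLN`, `blkHHN` (BHK06 1.4), `blkM1`, `blkM2` (BHK06 1.4 with a root cluster avoiding `{other root, b}`).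
-/

namespace Summit.Ventures.PercRepro2

namespace HalfLA1B

open CaseOne HalfLTwoMark HalfLA2B

section Blocks

variable {V : Type*} {E : Type*} [Fintype E] [DecidableEq E] [Fintype V] [DecidableEq V]
  {R : Type*} [Field R] [LinearOrder R] [IsStrictOrderedRing R]

omit [Fintype V] [DecidableEq V] in
/-- The cells of a probability vector are nonnegative. -/
theorem cellsNonneg (p : E → R) (hp : IsProbVec p) (ends : E → Sym2 V) (o a₁ a₂ b : V) (eo eb : E) :
    (cellsA1B p ends o a₁ a₂ b eo eb).Nonneg := by
  have hp00 : IsProbVec (Function.update (Function.update p eo 0) eb 0) :=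
    (hp.update eo le_rfl zero_le_one).update eb le_rfl zero_le_one
  unfold Cells10.Nonneg cellsA1B cells10Of
  dsimp only
  exact ⟨prob_nonneg hp00 _, prob_nonneg hp00 _, prob_nonneg hp00 _, prob_nonneg hp00 _,
    prob_nonneg hp00 _, prob_nonneg hp00 _, prob_nonneg hp00 _, prob_nonneg hp00 _, prob_nonneg hp00 _,
    prob_nonneg hp00 _⟩

/-- **The five blocks are nonnegative** on the ten cells of the base law of a probability vector. -/
theorem blocksNonneg (p : E → R) (hp : IsProbVec p) (ends : E → Sym2 V) (o a₁ a₂ b : V) (eo eb : E) :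
    BlocksNonneg (cellsA1B p ends o a₁ a₂ b eo eb) := by
  set p00 := Function.update (Function.update p eo 0) eb 0 with hp00
  have hp0 : IsProbVec p00 := (hp.update eo le_rfl zero_le_one).update eb le_rfl zero_le_one
  -- the cell decompositions of the base masses
  have tot := total_cells p00 ends o b a₁ a₂
  have nn := split_NN p00 ends o a₁ a₂ b
  rw [nn] at tot
  have oL := split_b p00 ends b a₁ a₂ (connEvent ends a₁ o)
  have oH := split_b p00 ends b a₁ a₂ (connEvent ends a₂ o)
  have bL := split_o p00 ends o a₁ a₂ (connEvent ends a₁ b)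
  have bH := split_o p00 ends o a₁ a₂ (connEvent ends a₂ b)
  have eHL : prob p00 ((connEvent ends a₁ a₂)ᶜ ∩ connEvent ends a₁ b ∩ connEvent ends a₂ o) =
      prob p00 ((connEvent ends a₁ a₂)ᶜ ∩ connEvent ends a₂ o ∩ connEvent ends a₁ b) :=
    prob_congr_set p00 (Set.inter_right_comm _ _ _)
  have eLH : prob p00 ((connEvent ends a₁ a₂)ᶜ ∩ connEvent ends a₂ b ∩ connEvent ends a₁ o) =
      prob p00 ((connEvent ends a₁ a₂)ᶜ ∩ connEvent ends a₁ o ∩ connEvent ends a₂ b) :=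
    prob_congr_set p00 (Set.inter_right_comm _ _ _)
  -- the atoms
  have hHH := tm_bhk_same_a2 p00 hp0 ends o a₁ a₂ b
  have hLLN := tm_bhk_cross_o1_b2 p00 hp0 ends o a₁ a₂ b
  have hHHN := tm_bhk_cross_b1_o2 p00 hp0 ends o a₁ a₂ b
  rw [eHL] at hHHN
  have hM1 := bhk_avoid_M1 p00 hp0 ends o a₁ a₂ b
  have hM2 := bhk_avoid_M1 p00 hp0 ends o a₂ a₁ b
  rw [connEvent_comm ends a₂ a₁] at hM2
  -- assemble
  unfold BlocksNonneg blkHH blkLLN blkHHN blkM1 blkM2 cellsA1B cells10Of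
  dsimp only
  rw [← hp00]
  rw [tot] at hHH hLLN hHHN hM1 hM2
  rw [oL] at hLLN hM1
  rw [oH] at hHH hHHN hM2
  rw [bL] at hHHN hM2 hM1
  rw [bH] at hHH hLLN hM1 hM2
  refine ⟨?_, ?_, ?_, ?_, ?_⟩
  · linear_combination hHH
  · linear_combination hLLN
  · linear_combination hHHN
  · linear_combination hM1
  · linear_combination hM2

end Blocks

end HalfLA1B

end Summit.Ventures.PercRepro2
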